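import Literature.MathematicalPhysics.QuantumLattice.HubbardFreeCovariance
import Literature.Analysis.Calculus.ExpNegInvGlueGevrey
import HarnessLib

/-!
# The GEVREY-2 TABLE of Salmhofer's ultraviolet cutoff `χ₂` with NUMERALS: `‖χ₂^{(n)}‖_∞ ≤ 8·(n!)²·342ⁿ` for every `n`

Topic `MathematicalPhysics/QuantumLattice`; continues `SalmhoferCutoffDerivBounds` (which has only `∃ B, ∀ i ≤ N, ‖χ₂^{(i)}‖ ≤ B`).  The tree's cutoff is
`salmhoferCutoff x = Real.smoothTransition ((4x − 1)/3)` (`HubbardFreeCovariance`; Salmhofer 1999 (4.71)); by the explicit Gevrey-2 table of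
`Real.smoothTransition` (`Literature.Analysis.Calculus.abs_iteratedDeriv_smoothTransition_le_numeral`: `≤ 8·(n!)²·256ⁿ`) and the affine chain rule
(factor `(4/3)ⁿ`, `4·256/3 ≤ 342`) every derivative of `χ₂` is bounded by `8·(n!)²·342ⁿ`.  This DISCHARGES, with numerals and no `∃`, the cutoff-table
hypotheses that the smooth-cutoff bookkeeping of the fermionic multiscale expansion carries (Disertori–Rivasseau 2000 §II.2 footnote to (II.13)–(II.14):
a Gevrey cutoff; Benfatto–Giuliani–Mastropietro 2006 §2.2 (2.9): a smooth compact-support cutoff) — in the cell gate-hubbard-kl these are the hypotheses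
`hXG : ∀ l ≤ Md, ∀ x, ‖iteratedFDeriv ℝ l salmhoferCutoff x‖ ≤ X₀·(l!)²·C_χ^l` (now `X₀ = 8`, `C_χ = 342`), `hX4 : ∀ l ≤ 4, … ≤ X₄` (now
`X₄ = 8·576·342⁴`) and `hB : ∀ y, |χ₂′(y)| ≤ B₁` (now `B₁ = 2736`) of the frame-response door `…EngineFrameShiftDressingSupFlowTablesG` (located risk
«(C)-B-ALIAS-L»).  The numerals are crude (the true `sup|χ₂′|` is `< 3`); they are powers the aliasing threshold absorbs with room to spare.

* `salmhoferCutoff_eq_comp_affine` — `χ₂ = (z ↦ smoothTransition(z − 1/3)) ∘ (x ↦ (4/3)x)`;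
* `iteratedDeriv_salmhoferCutoff` — `χ₂^{(n)}(x) = (4/3)ⁿ·smoothTransition^{(n)}((4/3)x − 1/3)`;
* **`abs_iteratedDeriv_salmhoferCutoff_le_gevrey`** / **`norm_iteratedFDeriv_salmhoferCutoff_le_gevrey`** — `≤ 8·(n!)²·342ⁿ`, all `n`, all `x`;
* `salmhoferCutoff_gevrey_table` — the table form `∀ l ≤ N, ∀ x, ‖D^lχ₂(x)‖ ≤ 8·(l!)²·342^l` (any `N`);
* `salmhoferCutoff_flat_table_four` — `∀ l ≤ 4, ∀ x, ‖D^lχ₂(x)‖ ≤ 8·576·342⁴`; `abs_deriv_salmhoferCutoff_le_numeral` — `|χ₂′(y)| ≤ 2736`.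

Everything is proved; no definitions; no named facts.

## Sources

M. Salmhofer, *Renormalization*, Springer 1999, §4.2.5 (4.70)–(4.71) [`Salmhofer1999`] (the cutoff `χ₂`);
M. Disertori, V. Rivasseau, Commun. Math. Phys. 215 (2000) 251–290, §II.2 (II.13)–(II.14) footnote [`DisertoriRivasseau2000`] (Gevrey cutoffs);
G. Benfatto, A. Giuliani, V. Mastropietro, Ann. Henri Poincaré 7 (2006) 809–898, §2.2 (2.9) [`BenfattoGiulianiMastropietro2006`].
-/

noncomputable section

namespace Literature.MathematicalPhysics.QuantumLattice

open Real Literature.Analysis.Calculus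
open scoped Nat

/-- `χ₂` is the transition profile shifted by `1/3` and read at `(4/3)x`: `χ₂(x) = smoothTransition((4/3)x − 1/3)`. [cite: Salmhofer1999, §4.2.5 (4.71)] -/
theorem salmhoferCutoff_eq_comp_affine :
    salmhoferCutoff = fun x : ℝ => (fun z : ℝ => Real.smoothTransition (z - 1 / 3)) ((4 / 3 : ℝ) * x) := by
  funext x
  simp only [salmhoferCutoff]
  congr 1
  ring

/-- **The derivatives of `χ₂` through the affine chain rule**: `χ₂^{(n)}(x) = (4/3)ⁿ·smoothTransition^{(n)}((4/3)x − 1/3)`. [cite: Salmhofer1999, §4.2.5 (4.71)] -/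
theorem iteratedDeriv_salmhoferCutoff (n : ℕ) (x : ℝ) :
    iteratedDeriv n salmhoferCutoff x = (4 / 3 : ℝ) ^ n * iteratedDeriv n Real.smoothTransition ((4 / 3 : ℝ) * x - 1 / 3) := by
  have hg : ContDiff ℝ n (fun z : ℝ => Real.smoothTransition (z - 1 / 3)) :=
    Real.smoothTransition.contDiff.comp (contDiff_id.sub contDiff_const)
  rw [salmhoferCutoff_eq_comp_affine, iteratedDeriv_comp_const_mul hg (4 / 3 : ℝ)]
  dsimp only
  rw [iteratedDeriv_comp_sub_const n Real.smoothTransition (1 / 3)]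

/-- `(4/3)ⁿ·256ⁿ ≤ 342ⁿ`. [cite: Salmhofer1999, §4.2.5 (4.71)] -/
theorem four_thirds_pow_mul_pow_le (n : ℕ) : (4 / 3 : ℝ) ^ n * 256 ^ n ≤ 342 ^ n := by
  rw [← mul_pow]
  exact pow_le_pow_left₀ (by norm_num) (by norm_num) n

/-- **THE GEVREY-2 TABLE OF `χ₂` WITH NUMERALS**: `|χ₂^{(n)}(x)| ≤ 8·(n!)²·342ⁿ` for every `n` and every `x` (the Gevrey class posited for the
cutoff in Disertori–Rivasseau's footnote, here `s = 2`, proved for Salmhofer's `χ₂`). [cite: DisertoriRivasseau2000, §II.2 (II.14) footnote p0004:L18–26] -/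
theorem abs_iteratedDeriv_salmhoferCutoff_le_gevrey (n : ℕ) (x : ℝ) :
    |iteratedDeriv n salmhoferCutoff x| ≤ 8 * ((n ! : ℝ)) ^ 2 * 342 ^ n := by
  rw [iteratedDeriv_salmhoferCutoff, abs_mul, abs_pow, abs_of_pos (by norm_num : (0 : ℝ) < 4 / 3)]
  calc (4 / 3 : ℝ) ^ n * |iteratedDeriv n Real.smoothTransition (4 / 3 * x - 1 / 3)|
      ≤ (4 / 3 : ℝ) ^ n * (8 * ((n ! : ℝ)) ^ 2 * 256 ^ n) :=
        mul_le_mul_of_nonneg_left (abs_iteratedDeriv_smoothTransition_le_numeral n _) (by positivity)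
    _ = 8 * ((n ! : ℝ)) ^ 2 * ((4 / 3 : ℝ) ^ n * 256 ^ n) := by ring
    _ ≤ 8 * ((n ! : ℝ)) ^ 2 * 342 ^ n := by gcongr; exact four_thirds_pow_mul_pow_le n

/-- Fréchet form: `‖iteratedFDeriv ℝ n χ₂ x‖ ≤ 8·(n!)²·342ⁿ`. [cite: DisertoriRivasseau2000, §II.2 (II.14) footnote p0004:L18–26] -/
theorem norm_iteratedFDeriv_salmhoferCutoff_le_gevrey (n : ℕ) (x : ℝ) :
    ‖iteratedFDeriv ℝ n salmhoferCutoff x‖ ≤ 8 * ((n ! : ℝ)) ^ 2 * 342 ^ n := by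
  rw [norm_iteratedFDeriv_eq_norm_iteratedDeriv, Real.norm_eq_abs]
  exact abs_iteratedDeriv_salmhoferCutoff_le_gevrey n x

/-- **The table form** consumed by the multiscale bookkeeping: for any cut-off order `N`, `∀ l ≤ N, ∀ x, ‖D^l χ₂(x)‖ ≤ 8·(l!)²·342^l`
(i.e. the Gevrey table hypothesis with `X₀ = 8`, `C_χ = 342`). [cite: DisertoriRivasseau2000, §II.2 (II.14) footnote p0004:L18–26] -/
theorem salmhoferCutoff_gevrey_table (N : ℕ) :
    ∀ l ≤ N, ∀ x : ℝ, ‖iteratedFDeriv ℝ l salmhoferCutoff x‖ ≤ 8 * ((l ! : ℝ)) ^ 2 * (342 : ℝ) ^ l :=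
  fun l _ x => norm_iteratedFDeriv_salmhoferCutoff_le_gevrey l x

/-- **The flat order-`4` table**: `∀ l ≤ 4, ∀ x, ‖D^l χ₂(x)‖ ≤ 8·576·342⁴` (`(l!)² ≤ (4!)² = 576`, `342^l ≤ 342⁴`).
[cite: BenfattoGiulianiMastropietro2006, §2.2 (2.9)] -/
theorem salmhoferCutoff_flat_table_four :
    ∀ l ≤ 4, ∀ x : ℝ, ‖iteratedFDeriv ℝ l salmhoferCutoff x‖ ≤ 8 * 576 * (342 : ℝ) ^ 4 := by
  intro l hl x
  refine (norm_iteratedFDeriv_salmhoferCutoff_le_gevrey l x).trans ?_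
  have hfac : ((l ! : ℝ)) ^ 2 ≤ 576 := by
    have h1 : l ! ≤ 4 ! := Nat.factorial_le hl
    have h2 : ((l ! : ℝ)) ≤ 24 := by exact_mod_cast h1
    have h0 : (0 : ℝ) ≤ l ! := by positivity
    nlinarith
  have hpow : (342 : ℝ) ^ l ≤ 342 ^ 4 := pow_le_pow_right₀ (by norm_num) hl
  calc 8 * ((l ! : ℝ)) ^ 2 * 342 ^ l ≤ 8 * 576 * 342 ^ l := by gcongr
    _ ≤ 8 * 576 * 342 ^ 4 := by gcongr

/-- **A numeral bound on the first derivative**: `|χ₂′(y)| ≤ 2736` (`= 8·342`; crude — the true supremum is below `3`).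
[cite: Salmhofer1999, §4.2.5 (4.71)] -/
theorem abs_deriv_salmhoferCutoff_le_numeral (y : ℝ) : |deriv salmhoferCutoff y| ≤ 2736 := by
  have h := abs_iteratedDeriv_salmhoferCutoff_le_gevrey 1 y
  rw [iteratedDeriv_one] at h
  norm_num at h
  exact h

end Literature.MathematicalPhysics.QuantumLattice

end
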